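import Mathlib
import Literature.NumberTheory.Transcendental.KZCalculus
import Literature.NumberTheory.Transcendental.KZLogCalculusProofs
import Summits.KontsevichZagierPeriods.KontsevichZagierPeriods.Theses.UnfoldedStokes

/-!
# `HyperellipticRiemannRelation` (stmt-KontsevichZagierPeriods-3522), line `SketchIdeator2`:
# kernel calculus II — decay of the kernels and the compactified height

Auxiliary file for the registered stub `stub_kernelCalculus`. From the pointwise bounds of the
line (`stub_bounds`, entering here as the HYPOTHESIS `hbd`:
`‖1/Φ(x+is)‖ ≤ C m(x) (1+s²)^{−5/8}`, `‖(x+is)/Φ(x+is)‖ ≤ C m(x) (1+s²)^{−1/8}` for `s ≥ 0`, `x`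
off the branch points, with the weight `m(x) = (1 + Σₖ |x−eₖ|^{−3/4}) (1+x²)^{−5/8}`) we derive:

* `m(x) → 0` as `|x| → ∞`, `(1+s²)^r → 0` as `s → ∞` (`r < 0`);
* decay of the simplex kernel `K(x₀,x₁,s) = (x₁+is)/(Φ(x₀+is)Φ(x₁+is))` as `s → ∞` (abscissae off
  the branch points) and of `τ ↦ K(τ−a,τ,s)` as `τ → ±∞` (`s ≥ 0`); the same for the one-point
  kernel `k(x,s) = (x+is)/Φ(x+is)`;
* the compactified height `σ ↦ σ/(1−σ)`: it tends to `+∞` at `1⁻`, and a function that reads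
  `g(σ/(1−σ))` below `σ = 1` and `0` at `σ = 1` is continuous on `[0,1]` once `g` is continuous on
  `[0,∞)` with limit `0` at `∞`;
* the two bases of the engine, `{u > 0, τ ∉ E, τ−u ∉ E}` and `A × (ℝ ∖ E)`, have full measure
  (their complements lie on finitely many lines); the latter is `ℚ`-semialgebraic (the former is
  `Faces.isSemialgebraic_shearBase` of the sibling file `…StubFacesReps.lean`).

Registered auxiliary stub: `stub_kernelCalculusAux2` (decay of `K` along the joint translation).
No definitions. References: Kontsevich–Zagier 2001, §1.2 rule (3); Farkas–Kra 1992, III.3.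
-/

noncomputable section

namespace Summit.KontsevichZagierPeriods.UnfoldedStokes.HyperellipticRiemannRelationLine

open Set MeasureTheory Filter Topology
open Literature.NumberTheory.Transcendental
open Literature.ModelTheory.ExponentialFields (IsSemialgebraic)

namespace KernelCalculus

/-! ## Elementary limits -/

/-- Along a filter on which `|τ| → ∞`, eventually `τ − a` is off the branch points. [folklore] -/
theorem eventually_ne_branch {e : Fin 5 → ℚ} {l : Filter ℝ}
    (hl : Tendsto (fun τ : ℝ => |τ|) l atTop) (a : ℝ) : ∀ᶠ τ in l, ∀ j, τ - a ≠ (e j : ℝ) := by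
  have h : Tendsto (fun τ => |τ - a|) l atTop := by
    refine tendsto_atTop_mono (fun τ => ?_) (tendsto_atTop_add_const_right _ (-|a|) hl)
    have := abs_sub_abs_le_abs_sub τ a
    linarith
  refine Filter.eventually_all.2 fun j => ?_
  filter_upwards [h.eventually_gt_atTop |(e j : ℝ)|] with τ hτ heq
  rw [heq] at hτ
  exact lt_irrefl _ hτ

section Decay

variable {e : Fin 5 → ℚ} {Φ : ℂ → ℂ} {m : ℝ → ℝ} {K : ℝ → ℝ → ℝ → ℂ} {k : ℝ → ℝ → ℂ}
  (hm : ∀ x, m x =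
    (1 + ∑ k : Fin 5, |x - (e k : ℝ)| ^ (-(3:ℝ) / 4)) * (1 + x ^ 2) ^ (-(5:ℝ) / 8))
  (hbd : ∃ C : ℝ, 0 < C ∧ ∀ (x s : ℝ), 0 ≤ s → (∀ j, x ≠ (e j : ℝ)) →
      ‖(Φ ((x : ℂ) + (s : ℂ) * Complex.I))⁻¹‖ ≤ C * m x * (1 + s ^ 2) ^ (-(5:ℝ) / 8) ∧
      ‖((x : ℂ) + (s : ℂ) * Complex.I) / Φ ((x : ℂ) + (s : ℂ) * Complex.I)‖ ≤
        C * m x * (1 + s ^ 2) ^ (-(1:ℝ) / 8) ∧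
      (0 < s →
        ‖(Φ ((x : ℂ) + (s : ℂ) * Complex.I))⁻¹ *
            ∑ j : Fin 5, ((x : ℂ) + (s : ℂ) * Complex.I - ((e j : ℝ) : ℂ))⁻¹‖ ≤
          C * m x * (1 + s ^ (-(3:ℝ) / 4)) * (1 + s ^ 2) ^ (-(9:ℝ) / 8) ∧
        ‖(1 - ((x : ℂ) + (s : ℂ) * Complex.I) / 2 *
              ∑ j : Fin 5, ((x : ℂ) + (s : ℂ) * Complex.I - ((e j : ℝ) : ℂ))⁻¹) /
            Φ ((x : ℂ) + (s : ℂ) * Complex.I)‖ ≤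
          C * m x * (1 + s ^ (-(3:ℝ) / 4)) * (1 + s ^ 2) ^ (-(5:ℝ) / 8)))
  (hK : ∀ x₀ x₁ s, K x₀ x₁ s = ((x₁ : ℂ) + (s : ℂ) * Complex.I) /
      (Φ ((x₀ : ℂ) + (s : ℂ) * Complex.I) * Φ ((x₁ : ℂ) + (s : ℂ) * Complex.I)))
  (hk : ∀ x s, k x s = ((x : ℂ) + (s : ℂ) * Complex.I) / Φ ((x : ℂ) + (s : ℂ) * Complex.I))

include hm in
/-- **The weight decays**: `m(g) → 0` along any filter on which `|g| → ∞`
(`|x − eₖ|^{−3/4} → 0` and `(1+x²)^{−5/8} → 0`). [folklore] -/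
theorem tendsto_m {α : Type*} {l : Filter α} {g : α → ℝ} (hg : Tendsto (fun a => |g a|) l atTop) :
    Tendsto (fun a => m (g a)) l (𝓝 0) := by
  simp only [hm]
  rw [show (0:ℝ) = (1 + ∑ k : Fin 5, (0:ℝ)) * 0 by simp]
  refine Tendsto.mul (tendsto_const_nhds.add (tendsto_finsetSum _ fun k _ => ?_)) ?_
  · have hk : Tendsto (fun a => |g a - (e k : ℝ)|) l atTop := by
      refine tendsto_atTop_mono (fun a => ?_) (tendsto_atTop_add_const_right _ (-|(e k : ℝ)|) hg)
      have := abs_sub_abs_le_abs_sub (g a) (e k : ℝ)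
      linarith
    refine ((tendsto_rpow_neg_atTop (show (0:ℝ) < 3 / 4 by norm_num)).comp hk).congr fun a => ?_
    simp only [Function.comp_apply]
    norm_num [neg_div]
  · have h1 : Tendsto (fun a => 1 + (g a) ^ 2) l atTop := by
      refine tendsto_atTop_add_const_left _ _ ?_
      exact ((tendsto_pow_atTop two_ne_zero).comp hg).congr fun a => by simp [sq_abs]
    refine ((tendsto_rpow_neg_atTop (show (0:ℝ) < 5 / 8 by norm_num)).comp h1).congr fun a => ?_
    simp only [Function.comp_apply]
    norm_num [neg_div]

section K

include hbd hK

/-- **Decay of `K` in the height**: `K(x₀,x₁,s) → 0` as `s → ∞` for `x₀, x₁` off the branch points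
(`‖K‖ ≤ C² m(x₁) m(x₀) (1+s²)^{−1/8} (1+s²)^{−5/8}`). [folklore] -/
theorem tendsto_K_atTop {x₀ x₁ : ℝ} (h₀ : ∀ j, x₀ ≠ (e j : ℝ)) (h₁ : ∀ j, x₁ ≠ (e j : ℝ)) :
    Tendsto (fun s : ℝ => K x₀ x₁ s) atTop (𝓝 0) := by
  obtain ⟨C, -, hb⟩ := hbd
  have hbound : ∀ᶠ s : ℝ in atTop, ‖K x₀ x₁ s‖ ≤
      (C * m x₁ * (1 + s ^ 2) ^ (-(1:ℝ) / 8)) * (C * m x₀ * (1 + s ^ 2) ^ (-(5:ℝ) / 8)) := by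
    filter_upwards [eventually_ge_atTop (0:ℝ)] with s hs
    have hKs : K x₀ x₁ s = ((x₁ : ℂ) + (s : ℂ) * Complex.I) / Φ ((x₁ : ℂ) + (s : ℂ) * Complex.I) *
        (Φ ((x₀ : ℂ) + (s : ℂ) * Complex.I))⁻¹ := by
      rw [hK]; ring
    rw [hKs, norm_mul]
    exact mul_le_mul ((hb x₁ s hs h₁).2.1) ((hb x₀ s hs h₀).1) (norm_nonneg _)
      ((norm_nonneg _).trans (hb x₁ s hs h₁).2.1)
  have hdec : ∀ r : ℝ, r < 0 → Tendsto (fun s : ℝ => (1 + s ^ 2) ^ r) atTop (𝓝 0) := fun r hr => by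
    simpa [Function.comp_def] using (tendsto_rpow_neg_atTop (neg_pos.2 hr)).comp
      (tendsto_atTop_add_const_left _ _ (tendsto_pow_atTop two_ne_zero))
  refine squeeze_zero_norm' hbound ?_
  rw [show (0:ℝ) = (C * m x₁ * 0) * (C * m x₀ * 0) by ring]
  exact ((hdec _ (by norm_num)).const_mul _).mul ((hdec _ (by norm_num)).const_mul _)

include hm

/-- **Decay of `K` along the joint translation**: `K(τ−a, τ, s) → 0` as `|τ| → ∞` (`s ≥ 0`):
eventually both abscissae are off the branch points and `‖K‖ ≤ C² m(τ) m(τ−a)`. [folklore] -/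
theorem tendsto_K_τ (a : ℝ) {s : ℝ} (hs : 0 ≤ s) {l : Filter ℝ}
    (hl : Tendsto (fun τ : ℝ => |τ|) l atTop) : Tendsto (fun τ : ℝ => K (τ - a) τ s) l (𝓝 0) := by
  obtain ⟨C, -, hb⟩ := hbd
  have hbound : ∀ᶠ τ : ℝ in l, ‖K (τ - a) τ s‖ ≤
      (C * m τ * (1 + s ^ 2) ^ (-(1:ℝ) / 8)) * (C * m (τ - a) * (1 + s ^ 2) ^ (-(5:ℝ) / 8)) := by
    filter_upwards [eventually_ne_branch hl a, eventually_ne_branch (e := e) hl 0] with τ ha h0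
    simp only [sub_zero] at h0
    have hKs : K (τ - a) τ s = ((τ : ℂ) + (s : ℂ) * Complex.I) / Φ ((τ : ℂ) + (s : ℂ) * Complex.I) *
        (Φ (((τ - a : ℝ) : ℂ) + (s : ℂ) * Complex.I))⁻¹ := by
      rw [hK]; ring
    rw [hKs, norm_mul]
    exact mul_le_mul ((hb τ s hs h0).2.1) ((hb (τ - a) s hs ha).1) (norm_nonneg _)
      ((norm_nonneg _).trans (hb τ s hs h0).2.1)
  refine squeeze_zero_norm' hbound ?_
  rw [show (0:ℝ) = (C * 0 * (1 + s ^ 2) ^ (-(1:ℝ) / 8)) * (C * 0 * (1 + s ^ 2) ^ (-(5:ℝ) / 8))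
    by ring]
  have hg : Tendsto (fun τ : ℝ => |τ - a|) l atTop := by
    refine tendsto_atTop_mono (fun τ => ?_) (tendsto_atTop_add_const_right _ (-|a|) hl)
    have := abs_sub_abs_le_abs_sub τ a
    linarith
  exact (((tendsto_m hm hl).const_mul C).mul_const _).mul
    (((tendsto_m hm hg).const_mul C).mul_const _)

end K

section k

include hbd hk

/-- Decay of `k(x,s)` as `s → ∞` for `x` off the branch points. [folklore] -/
theorem tendsto_k_atTop {x : ℝ} (hx : ∀ j, x ≠ (e j : ℝ)) :
    Tendsto (fun s : ℝ => k x s) atTop (𝓝 0) := by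
  obtain ⟨C, -, hb⟩ := hbd
  have hbound : ∀ᶠ s : ℝ in atTop, ‖k x s‖ ≤ C * m x * (1 + s ^ 2) ^ (-(1:ℝ) / 8) := by
    filter_upwards [eventually_ge_atTop (0:ℝ)] with s hs
    rw [hk]
    exact (hb x s hs hx).2.1
  have hdec : Tendsto (fun s : ℝ => (1 + s ^ 2) ^ (-(1:ℝ) / 8)) atTop (𝓝 0) := by
    simpa [Function.comp_def] using (tendsto_rpow_neg_atTop (show (0:ℝ) < -(-(1:ℝ) / 8) by
      norm_num)).comp (tendsto_atTop_add_const_left _ _ (tendsto_pow_atTop two_ne_zero))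
  refine squeeze_zero_norm' hbound ?_
  rw [show (0:ℝ) = C * m x * 0 by ring]
  exact hdec.const_mul _

include hm

/-- Decay of `k(τ,s)` as `|τ| → ∞` (`s ≥ 0`). [folklore] -/
theorem tendsto_k_τ {s : ℝ} (hs : 0 ≤ s) {l : Filter ℝ} (hl : Tendsto (fun τ : ℝ => |τ|) l atTop) :
    Tendsto (fun τ : ℝ => k τ s) l (𝓝 0) := by
  obtain ⟨C, -, hb⟩ := hbd
  have hbound : ∀ᶠ τ : ℝ in l, ‖k τ s‖ ≤ C * m τ * (1 + s ^ 2) ^ (-(1:ℝ) / 8) := by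
    filter_upwards [eventually_ne_branch (e := e) hl 0] with τ h0
    simp only [sub_zero] at h0
    rw [hk]
    exact (hb τ s hs h0).2.1
  refine squeeze_zero_norm' hbound ?_
  rw [show (0:ℝ) = C * 0 * (1 + s ^ 2) ^ (-(1:ℝ) / 8) by ring]
  exact ((tendsto_m hm hl).const_mul C).mul_const _

end k

end Decay

/-! ## The compactified height `s = σ/(1−σ)` -/

/-- `σ/(1−σ) → +∞` as `σ → 1⁻`. [folklore] -/
theorem tendsto_height : Tendsto (fun σ : ℝ => σ / (1 - σ)) (𝓝[<] 1) atTop := by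
  have h1 : Tendsto (fun σ : ℝ => 1 - σ) (𝓝[<] (1:ℝ)) (𝓝[>] 0) := by
    refine tendsto_nhdsWithin_iff.2 ⟨?_, ?_⟩
    · have : Tendsto (fun σ : ℝ => 1 - σ) (𝓝 1) (𝓝 (1 - 1)) :=
        (continuous_const.sub continuous_id).tendsto 1
      simpa using this.mono_left nhdsWithin_le_nhds
    · filter_upwards [self_mem_nhdsWithin] with σ hσ
      exact sub_pos.2 (mem_Iio.1 hσ)
  have h3 : Tendsto (fun σ : ℝ => σ) (𝓝[<] (1:ℝ)) (𝓝 1) :=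
    (continuous_id.tendsto 1).mono_left nhdsWithin_le_nhds
  simpa [div_eq_mul_inv] using h3.pos_mul_atTop one_pos (tendsto_inv_nhdsGT_zero.comp h1)

/-- **Continuity on the closed height interval.** If `f(σ) = g(σ/(1−σ))` for `σ < 1`, `f(1) = 0`,
`g` is continuous on `[0,∞)` and `g → 0` at `∞`, then `f` is continuous on `[0,1]`. [folklore] -/
theorem continuousOn_Icc_of_height {f g : ℝ → ℝ} (hfg : ∀ σ, σ < 1 → f σ = g (σ / (1 - σ)))
    (hf1 : f 1 = 0) (hg : ContinuousOn g (Ici 0)) (hlim : Tendsto g atTop (𝓝 0)) :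
    ContinuousOn f (Icc 0 1) := by
  have hc : ContinuousOn (fun σ : ℝ => σ / (1 - σ)) (Ico 0 1) := by
    refine ContinuousOn.div continuousOn_id (continuousOn_const.sub continuousOn_id) fun σ hσ => ?_
    exact sub_ne_zero.2 (ne_of_gt hσ.2)
  have hmaps : MapsTo (fun σ : ℝ => σ / (1 - σ)) (Ico 0 1) (Ici 0) := fun σ hσ =>
    div_nonneg hσ.1 (sub_nonneg.2 hσ.2.le)
  have hIco : ContinuousOn f (Ico 0 1) := (hg.comp hc hmaps).congr fun σ hσ => hfg σ hσ.2
  intro σ hσ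
  rcases eq_or_lt_of_le hσ.2 with rfl | hσ1
  · have hlt : Tendsto f (𝓝[<] 1) (𝓝 0) := by
      refine (hlim.comp tendsto_height).congr' ?_
      filter_upwards [self_mem_nhdsWithin] with σ hσ
      exact (hfg σ hσ).symm
    have h2 : ContinuousWithinAt f (Iic 1) 1 := by
      rw [← continuousWithinAt_Iio_iff_Iic, ContinuousWithinAt, hf1]
      exact hlt
    exact h2.mono Icc_subset_Iic_self
  · refine (hIco σ ⟨hσ.1, hσ1⟩).mono_of_mem_nhdsWithin ?_
    have : Ico (0:ℝ) 1 = Icc 0 1 ∩ Iio 1 := by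
      ext x
      exact ⟨fun h => ⟨⟨h.1, h.2.le⟩, h.2⟩, fun h => ⟨h.1.1, h.2⟩⟩
    rw [this]
    exact inter_mem_nhdsWithin _ (Iio_mem_nhds hσ1)

/-! ## The two bases: semialgebraic, of full measure -/

/-- `{y | p(y) ∉ E}` is `ℚ`-semialgebraic for a polynomial `p` over `ℚ` (`E` the rational branch
points). [cite: BochnakCosteRoy1998, §2.1] -/
theorem isSemialgebraic_ne_branch (e : Fin 5 → ℚ) {n : ℕ} (p : MvPolynomial (Fin n) ℚ) :
    IsSemialgebraic ℚ {y : Fin n → ℝ | ∀ j, MvPolynomial.aeval y p ≠ (e j : ℝ)} := by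
  have h := IsSemialgebraic.biInter (k := ℚ) (R := ℝ) Finset.univ _ fun j _ =>
    Literature.ModelTheory.ExponentialFields.isSemialgebraic_setOf_eval_ne_zero (k := ℚ) (R := ℝ)
      (p - MvPolynomial.C (e j))
  convert h using 1
  ext y
  simp [sub_eq_zero]

/-- The column base `A × (ℝ ∖ E)` is `ℚ`-semialgebraic for `A` `ℚ`-semialgebraic.
[cite: BochnakCosteRoy1998, §2.1] -/
theorem isSemialgebraic_baseII (e : Fin 5 → ℚ) {A : Set ℝ}
    (hA : IsSemialgebraic ℚ {t : Fin 1 → ℝ | t 0 ∈ A}) :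
    IsSemialgebraic ℚ {y : Fin 2 → ℝ | y 0 ∈ A ∧ ∀ j, y 1 ≠ (e j : ℝ)} := by
  have h0 : IsSemialgebraic ℚ {y : Fin 2 → ℝ | y 0 ∈ A} := hA.preimage_comp fun _ : Fin 1 => 0
  have h1 := isSemialgebraic_ne_branch e (MvPolynomial.X 1 : MvPolynomial (Fin 2) ℚ)
  simp only [MvPolynomial.aeval_X] at h1
  exact h0.inter h1

/-- A diagonal line `{y 1 = y 0 + c}` in `ℝ²` is null (a graph). [folklore] -/
theorem volume_setOf_one_eq_zero_add (c : ℚ) :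
    volume {y : Fin 2 → ℝ | y 1 = y 0 + (c : ℝ)} = 0 := by
  have hu : IsSemialgebraicFunOn ℚ (univ : Set (Fin 1 → ℝ)) (fun x => x 0 + (c : ℝ)) :=
    (isSemialgebraicFunOn_aeval Literature.ModelTheory.ExponentialFields.isSemialgebraic_univ
      (MvPolynomial.X 0 + MvPolynomial.C c)).congr fun x _ => by simp
  refine measure_mono_null (fun y hy => ?_) (KZ.volume_graph_eq_zero hu)
  exact ⟨mem_univ _, by simpa [Fin.init] using hy⟩

/-- The simplex base has full measure in `{u > 0} × ℝ`: its complement lies on the ten lines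
`τ = eⱼ`, `τ − u = eⱼ`. [folklore] -/
theorem volume_diff_baseI (e : Fin 5 → ℚ) :
    volume ({y : Fin 2 → ℝ | y 0 ∈ Ioi (0:ℝ)} \
      {y | 0 < y 0 ∧ ∀ j, y 1 ≠ (e j : ℝ) ∧ y 1 - y 0 ≠ (e j : ℝ)}) = 0 := by
  refine measure_mono_null (fun y hy => ?_) (measure_iUnion_null fun j : Fin 5 =>
    measure_union_null (KZ.volume_setOf_last_eq_zero (n := 1) (e j : ℝ))
      (volume_setOf_one_eq_zero_add (e j)))
  have hy1 : 0 < y 0 := hy.1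
  have hy2 : ¬ (0 < y 0 ∧ ∀ j, y 1 ≠ (e j : ℝ) ∧ y 1 - y 0 ≠ (e j : ℝ)) := hy.2
  obtain ⟨j, hj⟩ : ∃ j, ¬ (y 1 ≠ (e j : ℝ) ∧ y 1 - y 0 ≠ (e j : ℝ)) := by
    by_contra h
    push Not at h
    exact hy2 ⟨hy1, fun j => ⟨(h j).1, (h j).2⟩⟩
  refine mem_iUnion.2 ⟨j, ?_⟩
  by_cases h : y 1 = (e j : ℝ)
  · exact Or.inl h
  · right
    have : ¬ (y 1 - y 0 ≠ (e j : ℝ)) := fun h' => hj ⟨h, h'⟩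
    push Not at this
    show y 1 = y 0 + (e j : ℝ)
    linarith

/-- The column base has full measure in `A × ℝ`: its complement lies on the lines `τ = eⱼ`.
[folklore] -/
theorem volume_diff_baseII (e : Fin 5 → ℚ) (A : Set ℝ) :
    volume ({y : Fin 2 → ℝ | y 0 ∈ A} \ {y | y 0 ∈ A ∧ ∀ j, y 1 ≠ (e j : ℝ)}) = 0 := by
  refine measure_mono_null (fun y hy => ?_) (measure_iUnion_null fun j : Fin 5 =>
    KZ.volume_setOf_last_eq_zero (n := 1) (e j : ℝ))
  have hy1 : y 0 ∈ A := hy.1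
  have hy2 : ¬ (y 0 ∈ A ∧ ∀ j, y 1 ≠ (e j : ℝ)) := hy.2
  obtain ⟨j, hj⟩ : ∃ j, y 1 = (e j : ℝ) := by
    by_contra h
    push Not at h
    exact hy2 ⟨hy1, h⟩
  exact mem_iUnion.2 ⟨j, show y (Fin.last 1) = (e j : ℝ) from hj⟩

end KernelCalculus

/-! ## Registered auxiliary stub: decay of the simplex kernel along the joint translation -/

/-- **Decay of the ordered simplex kernel at `τ = ±∞`.** With `Φ(z) = ∏ⱼ √(z − eⱼ)`, the weight
`m(x) = (1 + Σₖ |x−eₖ|^{−3/4}) (1+x²)^{−5/8}` and `K(x₀,x₁,s) = (x₁+is)/(Φ(x₀+is)Φ(x₁+is))`: if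
`‖1/Φ(x+is)‖ ≤ C m(x) (1+s²)^{−5/8}` and `‖(x+is)/Φ(x+is)‖ ≤ C m(x) (1+s²)^{−1/8}` for `s ≥ 0` and
`x` off the branch points, then for every spectator `a` and height `s ≥ 0`,
`K(τ−a, τ, s) → 0` as `τ → +∞` and as `τ → −∞`. [folklore] -/
theorem stub_kernelCalculusAux2 : ∀ (e : Fin 5 → ℚ) (Φ : ℂ → ℂ) (m : ℝ → ℝ)
    (K : ℝ → ℝ → ℝ → ℂ), (∀ x, m x = (1 + ∑ k : Fin 5, |x - (e k : ℝ)| ^ (-(3:ℝ) / 4)) *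
    (1 + x ^ 2) ^ (-(5:ℝ) / 8)) → (∃ C : ℝ, 0 < C ∧ ∀ (x s : ℝ), 0 ≤ s → (∀ j, x ≠ (e j : ℝ)) →
    ‖(Φ ((x : ℂ) + (s : ℂ) * Complex.I))⁻¹‖ ≤ C * m x * (1 + s ^ 2) ^ (-(5:ℝ) / 8) ∧
    ‖((x : ℂ) + (s : ℂ) * Complex.I) / Φ ((x : ℂ) + (s : ℂ) * Complex.I)‖ ≤ C * m x *
    (1 + s ^ 2) ^ (-(1:ℝ) / 8) ∧ (0 < s → ‖(Φ ((x : ℂ) + (s : ℂ) * Complex.I))⁻¹ *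
    ∑ j : Fin 5, ((x : ℂ) + (s : ℂ) * Complex.I - ((e j : ℝ) : ℂ))⁻¹‖ ≤ C * m x *
    (1 + s ^ (-(3:ℝ) / 4)) * (1 + s ^ 2) ^ (-(9:ℝ) / 8) ∧ ‖(1 - ((x : ℂ) + (s : ℂ) * Complex.I) /
    2 * ∑ j : Fin 5, ((x : ℂ) + (s : ℂ) * Complex.I - ((e j : ℝ) : ℂ))⁻¹) / Φ ((x : ℂ) + (s : ℂ) *
    Complex.I)‖ ≤ C * m x * (1 + s ^ (-(3:ℝ) / 4)) * (1 + s ^ 2) ^ (-(5:ℝ) / 8))) →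
    (∀ x₀ x₁ s, K x₀ x₁ s = ((x₁ : ℂ) + (s : ℂ) * Complex.I) / (Φ ((x₀ : ℂ) + (s : ℂ) *
    Complex.I) * Φ ((x₁ : ℂ) + (s : ℂ) * Complex.I))) → ∀ (a s : ℝ), 0 ≤ s →
    Tendsto (fun τ : ℝ => K (τ - a) τ s) atTop (𝓝 0) ∧
    Tendsto (fun τ : ℝ => K (τ - a) τ s) atBot (𝓝 0) := by
  intro e Φ m K hm hbd hK a s hs
  exact ⟨KernelCalculus.tendsto_K_τ hm hbd hK a hs tendsto_abs_atTop_atTop,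
    KernelCalculus.tendsto_K_τ hm hbd hK a hs tendsto_abs_atBot_atTop⟩

end Summit.KontsevichZagierPeriods.UnfoldedStokes.HyperellipticRiemannRelationLine
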